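import Literature.Probability.LatticeModels.TorusGreenHessianDecay
import Literature.Probability.LatticeModels.MaxwellKernelBand
import HarnessLib

/-!
# Supplements on the torus Green function `torusGreen` (toward LINE-18 stub K1, estimate (T) of STUB-PLAN-K1-24006)

Four facts about the zero-mode-removed Green function `G̃_L = torusGreen` of the discrete torus `(ℤ/Lℤ)^d`
(`Literature.Probability.LatticeModels.LatticeGreenFunction`) that the reflection construction of the Dirichlet/Neumann box
Green functions (`…AllWindowsColdBoxBoxKernelReflection`) needs:
* `torusGreen_reflect` — invariance under a coordinate sign flip `z_ν ↦ −z_ν`;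
* `torusGreen_laplacian` — `Σ_ν (2G̃(z) − G̃(z+e_ν) − G̃(z−e_ν)) = 2·[z = 0] − 2 L^{−d}` (`−Δ_T G̃ = 2(δ₀ − L^{−d})`);
* `torusGreen_hessian_le` (d = 4) — the tree's Calderón–Zygmund bound `torusGreen_hessian_mul_dist_pow_four_le` extended to ALL points:
  `|∇ᵢ⁺∇ⱼ⁻G̃_L(z)| · max(1, dist(0,z))⁴ ≤ C` for `L ≥ 2` (at `z = 0`: `i = j` from the Laplacian identity, `i ≠ j` by reflecting to `z = e_j`);
* `le_abs_valMinAbs_of_forall` — a lower bound for `|valMinAbs|` from a lower bound on all representatives.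
Pure consequences of tree theorems; no definitions; standard axioms.

HONEST LABEL: helper lemmas toward one registered stub (K1 `DirKernelDipoleDecay`, OPEN) of a critic-passed line on the R2ξ″ RECORD-rung
crux `AllWindowsColdBox.BulkMidWindowSU2` (stmt-QuantumFields-24006); no stub, crux, rung or summit is proved here; the Yang–Mills mass gap is
NOT proved by this file.
-/

set_option autoImplicit false

noncomputable section

open Finset ZMod
open scoped Real BigOperators ComplexConjugate

namespace Summit.QuantumFields.YangMills.Theorems.AllWindowsColdBox.BoxKernel

open Literature.Probability.LatticeModels

variable {d L : ℕ} [NeZero L]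

/-! ## Reflection invariance -/

/-- Flipping the sign of one coordinate of the character index and of the argument leaves the character unchanged. -/
theorem torusChar_update_neg (k z : TorusSite d L) (ν : Fin d) :
    torusChar (Function.update k ν (-k ν)) (Function.update z ν (-z ν)) = torusChar k z := by
  unfold torusChar
  refine Finset.prod_congr rfl fun i _ => ?_
  by_cases hi : i = ν
  · subst hi; simp
  · simp [Function.update_of_ne hi]

/-- The dispersion of a lattice momentum is invariant under a sign flip of one component (`cos(2π − θ) = cos θ`). -/
theorem dispersion_latticeMomentum_update_neg (k : TorusSite d L) (ν : Fin d) :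
    dispersion (latticeMomentum L (Function.update k ν (-k ν))) = dispersion (latticeMomentum L k) := by
  unfold dispersion latticeMomentum
  refine Finset.sum_congr rfl fun i _ => ?_
  by_cases hi : i = ν
  · subst hi
    simp only [Function.update_self]
    by_cases hk : k i = 0
    · simp [hk]
    · congr 1
      rw [ZMod.neg_val, if_neg hk]
      have hL : (0 : ℝ) < L := by exact_mod_cast Nat.pos_of_ne_zero (NeZero.ne L)
      have hle : (k i).val ≤ L := (ZMod.val_lt (k i)).le
      rw [Nat.cast_sub hle]
      have : 2 * π * ((L : ℝ) - ((k i).val : ℝ)) / L = 2 * π - 2 * π * ((k i).val : ℝ) / L := by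
        field_simp
      rw [this, Real.cos_two_pi_sub]
  · simp [Function.update_of_ne hi]

/-- **Reflection invariance of the torus Green function**: `G̃_L(…, −z_ν, …) = G̃_L(…, z_ν, …)` (reindex the Fourier sum by `k_ν ↦ −k_ν`). -/
theorem torusGreen_reflect (z : TorusSite d L) (ν : Fin d) :
    torusGreen (Function.update z ν (-z ν)) = torusGreen z := by
  unfold torusGreen
  congr 1
  -- the reflection of the index as an involution of `univ.erase 0`
  set r : TorusSite d L → TorusSite d L := fun k => Function.update k ν (-k ν) with hr
  have hr2 : ∀ k, r (r k) = k := fun k => by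
    funext i; by_cases hi : i = ν
    · subst hi; simp [hr]
    · simp [hr, Function.update_of_ne hi]
  have hr0 : ∀ k, r k = 0 ↔ k = 0 := by
    intro k; constructor
    · intro h; have := congrArg r h; rwa [hr2, show r 0 = 0 from by funext i; by_cases hi : i = ν <;> simp [hr, hi]] at this
    · intro h; subst h; funext i; by_cases hi : i = ν <;> simp [hr, hi]
  refine Finset.sum_nbij' r r (fun k hk => ?_) (fun k hk => ?_) (fun k _ => hr2 k) (fun k _ => hr2 k) (fun k _ => ?_)
  · exact Finset.mem_erase.2 ⟨fun h => (Finset.mem_erase.1 hk).1 ((hr0 k).1 h), Finset.mem_univ _⟩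
  · exact Finset.mem_erase.2 ⟨fun h => (Finset.mem_erase.1 hk).1 ((hr0 k).1 h), Finset.mem_univ _⟩
  · have hrk : Function.update (r k) ν (-(r k) ν) = k := hr2 k
    have ht : torusChar k (Function.update z ν (-z ν)) = torusChar (r k) z := by
      have := torusChar_update_neg (r k) z ν
      rwa [hrk] at this
    have hd : dispersion (latticeMomentum L k) = dispersion (latticeMomentum L (r k)) := by
      have := dispersion_latticeMomentum_update_neg (r k) ν
      rw [hrk] at this
      exact this
    rw [← torusChar_re, ← torusChar_re, ht, hd]

/-! ## The torus Laplacian of `G̃` -/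

/-- **`−Δ_T G̃_L = 2(δ₀ − L^{−d})`**: `Σ_ν (2G̃(z) − G̃(z+e_ν) − G̃(z−e_ν)) = 2·[z = 0] − 2/L^d`
(mode by mode `Σ_ν 2(1 − cos p_ν) = 2ε(p)` cancels the denominator; then character orthogonality). -/
theorem torusGreen_laplacian (z : TorusSite d L) :
    ∑ ν : Fin d, (2 * torusGreen z - torusGreen (z + Pi.single ν 1) - torusGreen (z - Pi.single ν 1)) =
      2 * (if z = 0 then 1 else 0) - 2 / (L : ℝ) ^ d := by
  classical
  have hLd : (0 : ℝ) < (L : ℝ) ^ d := by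
    have : (0 : ℝ) < L := by exact_mod_cast Nat.pos_of_ne_zero (NeZero.ne L)
    positivity
  simp_rw [torusGreen_second_difference]
  rw [← Finset.sum_div, Finset.sum_comm]
  have hmode : ∀ k ∈ (univ : Finset (TorusSite d L)).erase 0,
      ∑ ν : Fin d, 2 * (1 - Real.cos (latticeMomentum L k ν)) *
          Real.cos (∑ i, latticeMomentum L k i * ((z i).val : ℝ)) / dispersion (latticeMomentum L k) =
        2 * Real.cos (∑ i, latticeMomentum L k i * ((z i).val : ℝ)) := by
    intro k hk
    have hε : dispersion (latticeMomentum L k) ≠ 0 := (dispersion_latticeMomentum_pos (Finset.ne_of_mem_erase hk)).ne'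
    rw [← Finset.sum_div, ← Finset.sum_mul, ← Finset.mul_sum]
    unfold dispersion at hε ⊢
    field_simp
  rw [Finset.sum_congr rfl hmode, ← Finset.mul_sum]
  -- character orthogonality
  have hchar : ∑ k ∈ (univ : Finset (TorusSite d L)).erase 0, Real.cos (∑ i, latticeMomentum L k i * ((z i).val : ℝ)) =
      (if z = 0 then (L : ℝ) ^ d else 0) - 1 := by
    have hall : ∑ k : TorusSite d L, Real.cos (∑ i, latticeMomentum L k i * ((z i).val : ℝ)) =
        if z = 0 then (L : ℝ) ^ d else 0 := by
      simp_rw [← torusChar_re]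
      rw [← Complex.re_sum, sum_torusChar_left]
      split_ifs
      · rw [← Complex.ofReal_natCast, ← Complex.ofReal_pow, Complex.ofReal_re]
      · simp
    have h0 : ∀ i, latticeMomentum L (0 : TorusSite d L) i = 0 := fun i => by simp [latticeMomentum]
    have hcos0 : Real.cos (∑ i, latticeMomentum L (0 : TorusSite d L) i * (((0 : TorusSite d L) i).val : ℝ)) = 1 := by
      simp only [h0, zero_mul, Finset.sum_const_zero, Real.cos_zero]
    rw [Finset.sum_erase_eq_sub (Finset.mem_univ _), hall]
    have hcz : Real.cos (∑ i, latticeMomentum L (0 : TorusSite d L) i * ((z i).val : ℝ)) = 1 := by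
      simp only [h0, zero_mul, Finset.sum_const_zero, Real.cos_zero]
    rw [hcz]
  rw [hchar]
  split_ifs
  · field_simp
  · field_simp; ring

/-- Each directional second difference of `G̃` at the origin is nonnegative: `2G̃(0) − G̃(e_ν) − G̃(−e_ν) ≥ 0`. -/
theorem torusGreen_second_difference_zero_nonneg (ν : Fin d) :
    0 ≤ 2 * torusGreen (0 : TorusSite d L) - torusGreen ((0 : TorusSite d L) + Pi.single ν 1) -
      torusGreen ((0 : TorusSite d L) - Pi.single ν 1) := by
  rw [torusGreen_second_difference]
  refine div_nonneg (Finset.sum_nonneg fun k _ => ?_) (by positivity)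
  have h0 : (∑ i, latticeMomentum L k i * (((0 : TorusSite d L) i).val : ℝ)) = 0 := by simp
  rw [h0, Real.cos_zero, mul_one]
  exact div_nonneg (mul_nonneg zero_le_two (sub_nonneg.2 (Real.cos_le_one _))) (dispersion_nonneg _)

/-- `|2G̃(0) − G̃(e_ν) − G̃(−e_ν)| ≤ 2`: the directional second differences at the origin are nonnegative and sum to `2 − 2L^{−d}`. -/
theorem abs_torusGreen_second_difference_zero_le (ν : Fin d) :
    |2 * torusGreen (0 : TorusSite d L) - torusGreen ((0 : TorusSite d L) + Pi.single ν 1) -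
      torusGreen ((0 : TorusSite d L) - Pi.single ν 1)| ≤ 2 := by
  have hsum := torusGreen_laplacian (0 : TorusSite d L)
  rw [if_pos rfl] at hsum
  have hLd : 0 ≤ 2 / (L : ℝ) ^ d := by positivity
  rw [abs_of_nonneg (torusGreen_second_difference_zero_nonneg ν)]
  calc 2 * torusGreen (0 : TorusSite d L) - torusGreen ((0 : TorusSite d L) + Pi.single ν 1) -
        torusGreen ((0 : TorusSite d L) - Pi.single ν 1)
        ≤ ∑ μ : Fin d, (2 * torusGreen (0 : TorusSite d L) - torusGreen ((0 : TorusSite d L) + Pi.single μ 1) -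
            torusGreen ((0 : TorusSite d L) - Pi.single μ 1)) :=
        Finset.single_le_sum (fun μ _ => torusGreen_second_difference_zero_nonneg μ) (Finset.mem_univ ν)
    _ ≤ 2 := by rw [hsum]; linarith

/-! ## A uniform bound on the Hessian, all points (d = 4) -/

omit [NeZero L] in
/-- The Euclidean torus distance from `0` of a nonzero point is at least `1`. -/
theorem one_le_sqrt_sum_valMinAbs_sq {z : TorusSite d L} (hz : z ≠ 0) :
    1 ≤ Real.sqrt (∑ k, (((z k).valMinAbs : ℤ) : ℝ) ^ 2) := by
  obtain ⟨μ, hμ⟩ : ∃ μ, z μ ≠ 0 := by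
    by_contra h
    push Not at h
    exact hz (funext h)
  have h1 : (z μ).valMinAbs ≠ 0 := fun h => hμ ((ZMod.valMinAbs_eq_zero _).1 h)
  have h2 : (1 : ℝ) ≤ (((z μ).valMinAbs : ℤ) : ℝ) ^ 2 := by
    have : (1 : ℝ) ≤ |(((z μ).valMinAbs : ℤ) : ℝ)| := by
      rw [← Int.cast_abs]; exact_mod_cast Int.one_le_abs h1
    nlinarith [abs_nonneg (((z μ).valMinAbs : ℤ) : ℝ), sq_abs (((z μ).valMinAbs : ℤ) : ℝ)]
  rw [show (1 : ℝ) = Real.sqrt 1 by simp]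
  exact Real.sqrt_le_sqrt (h2.trans
    (Finset.single_le_sum (f := fun k => (((z k).valMinAbs : ℤ) : ℝ) ^ 2) (fun k _ => sq_nonneg _) (Finset.mem_univ μ)))

/-- **Uniform Hessian bound for the torus Green function, all points** (`d = 4`, `L ≥ 2`): there is an absolute `C` with
`|∇ᵢ⁺∇ⱼ⁻G̃_L(z)| · max(1, dist(0,z))⁴ ≤ C` for all `i, j, z` — the tree's Calderón–Zygmund bound off the origin, and at the origin
`|∇ᵢ⁺∇ᵢ⁻G̃(0)| ≤ 2` (Laplacian identity) resp. `∇ᵢ⁺∇ⱼ⁻G̃(0) = −∇ᵢ⁺∇ⱼ⁻G̃(e_j)` for `i ≠ j` (reflection `z_j ↦ −z_j`). -/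
theorem torusGreen_hessian_le : ∃ C : ℝ, 0 ≤ C ∧ ∀ (L : ℕ) [NeZero L], 2 ≤ L → ∀ (i j : Fin 4) (z : TorusSite 4 L),
    |torusGreen (z + Pi.single i 1) - torusGreen (z + Pi.single i 1 - Pi.single j 1) -
        torusGreen z + torusGreen (z - Pi.single j 1)| *
      (max 1 (Real.sqrt (∑ k, (((z k).valMinAbs : ℤ) : ℝ) ^ 2))) ^ 4 ≤ C := by
  obtain ⟨C₀, hC₀⟩ := torusGreen_hessian_mul_dist_pow_four_le
  have hC₀0 : 0 ≤ C₀ := by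
    -- evaluate at `L = 2`, `z = e_0 ≠ 0`
    haveI : NeZero (2 : ℕ) := ⟨by norm_num⟩
    have hz : (Pi.single (0 : Fin 4) (1 : ZMod 2) : TorusSite 4 2) ≠ 0 := by
      intro h; have := congrFun h 0; simp at this
    have h := hC₀ 2 0 0 _ hz
    exact le_trans (mul_nonneg (abs_nonneg _) (pow_nonneg (Real.sqrt_nonneg _) _)) h
  refine ⟨max C₀ 2, le_max_of_le_right zero_le_two, ?_⟩
  intro L _ hL i j z
  by_cases hz : z ≠ 0
  · have h1 := one_le_sqrt_sum_valMinAbs_sq hz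
    rw [max_eq_right h1]
    exact (hC₀ L i j z hz).trans (le_max_left _ _)
  · push Not at hz
    subst hz
    have hdist : Real.sqrt (∑ k, ((((0 : TorusSite 4 L) k).valMinAbs : ℤ) : ℝ) ^ 2) = 0 := by simp
    rw [hdist, max_eq_left zero_le_one, one_pow, mul_one]
    by_cases hij : i = j
    · subst hij
      have h := abs_torusGreen_second_difference_zero_le (d := 4) (L := L) i
      have e : torusGreen ((0 : TorusSite 4 L) + Pi.single i 1) -
          torusGreen ((0 : TorusSite 4 L) + Pi.single i 1 - Pi.single i 1) -
          torusGreen (0 : TorusSite 4 L) + torusGreen ((0 : TorusSite 4 L) - Pi.single i 1) =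
          -(2 * torusGreen (0 : TorusSite 4 L) - torusGreen ((0 : TorusSite 4 L) + Pi.single i 1) -
            torusGreen ((0 : TorusSite 4 L) - Pi.single i 1)) := by
        rw [add_sub_cancel_right]; ring
      rw [e, abs_neg]
      exact h.trans (le_max_right _ _)
    · -- reflect in the coordinate `j`
      have hej : (Pi.single j (1 : ZMod L) : TorusSite 4 L) ≠ 0 := by
        intro h
        have h1 := congrFun h j
        simp only [Pi.single_eq_same, Pi.zero_apply] at h1
        haveI : Fact (1 < L) := ⟨hL⟩
        exact one_ne_zero h1
      have hr1 : torusGreen ((0 : TorusSite 4 L) + Pi.single i 1 - Pi.single j 1) =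
          torusGreen ((Pi.single j 1 : TorusSite 4 L) + Pi.single i 1) := by
        have : Function.update ((0 : TorusSite 4 L) + Pi.single i 1 - Pi.single j 1 : TorusSite 4 L) j
            (-(((0 : TorusSite 4 L) + Pi.single i 1 - Pi.single j 1 : TorusSite 4 L) j)) =
            ((Pi.single j 1 : TorusSite 4 L) + Pi.single i 1 : TorusSite 4 L) := by
          funext k
          by_cases hk : k = j
          · subst hk; simp [Ne.symm hij]
          · simp [Function.update_of_ne hk, Pi.single_eq_of_ne hk]
        rw [← this, torusGreen_reflect]
      have hr2 : torusGreen ((0 : TorusSite 4 L) - Pi.single j 1) = torusGreen (Pi.single j 1 : TorusSite 4 L) := by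
        have : Function.update ((0 : TorusSite 4 L) - Pi.single j 1 : TorusSite 4 L) j
            (-(((0 : TorusSite 4 L) - Pi.single j 1 : TorusSite 4 L) j)) = (Pi.single j 1 : TorusSite 4 L) := by
          funext k
          by_cases hk : k = j
          · subst hk; simp
          · simp [Function.update_of_ne hk, Pi.single_eq_of_ne hk]
        rw [← torusGreen_reflect ((0 : TorusSite 4 L) - Pi.single j 1 : TorusSite 4 L) j, this]
      have h := hC₀ L i j (Pi.single j 1) hej
      have hd1 := one_le_sqrt_sum_valMinAbs_sq hej
      have e : torusGreen ((0 : TorusSite 4 L) + Pi.single i 1) -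
          torusGreen ((0 : TorusSite 4 L) + Pi.single i 1 - Pi.single j 1) -
          torusGreen (0 : TorusSite 4 L) + torusGreen ((0 : TorusSite 4 L) - Pi.single j 1) =
          -(torusGreen ((Pi.single j 1 : TorusSite 4 L) + Pi.single i 1) -
            torusGreen ((Pi.single j 1 : TorusSite 4 L) + Pi.single i 1 - Pi.single j 1) -
            torusGreen (Pi.single j 1 : TorusSite 4 L) + torusGreen ((Pi.single j 1 : TorusSite 4 L) - Pi.single j 1)) := by
        rw [hr1, hr2, zero_add, add_sub_cancel_left, sub_self]; ring
      rw [e, abs_neg]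
      calc |torusGreen ((Pi.single j 1 : TorusSite 4 L) + Pi.single i 1) -
              torusGreen ((Pi.single j 1 : TorusSite 4 L) + Pi.single i 1 - Pi.single j 1) -
              torusGreen (Pi.single j 1 : TorusSite 4 L) + torusGreen ((Pi.single j 1 : TorusSite 4 L) - Pi.single j 1)|
            ≤ |torusGreen ((Pi.single j 1 : TorusSite 4 L) + Pi.single i 1) -
              torusGreen ((Pi.single j 1 : TorusSite 4 L) + Pi.single i 1 - Pi.single j 1) -
              torusGreen (Pi.single j 1 : TorusSite 4 L) + torusGreen ((Pi.single j 1 : TorusSite 4 L) - Pi.single j 1)| *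
              Real.sqrt (∑ k, ((((Pi.single j 1 : TorusSite 4 L) k).valMinAbs : ℤ) : ℝ) ^ 2) ^ 4 :=
            le_mul_of_one_le_right (abs_nonneg _) (one_le_pow₀ hd1)
        _ ≤ C₀ := h
        _ ≤ max C₀ 2 := le_max_left _ _

/-! ## Representatives and `valMinAbs` -/

omit [NeZero L] in
/-- If every representative `m − P j` of the class of `m` modulo `P` has absolute value `≥ n`, then so does `valMinAbs (m : ZMod P)`. -/
theorem le_abs_valMinAbs_of_forall (P : ℕ) [NeZero P] (m : ℤ) (n : ℤ) (h : ∀ j : ℤ, n ≤ |m - P * j|) :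
    n ≤ |((m : ZMod P).valMinAbs : ℤ)| := by
  have hcast : (((m : ZMod P).valMinAbs : ℤ) : ZMod P) = (m : ZMod P) := ZMod.coe_valMinAbs _
  obtain ⟨j, hj⟩ := (ZMod.intCast_eq_intCast_iff_dvd_sub _ _ _).1 hcast
  have : ((m : ZMod P).valMinAbs : ℤ) = m - P * j := by linarith
  rw [this]
  exact h j

end Summit.QuantumFields.YangMills.Theorems.AllWindowsColdBox.BoxKernel

end
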